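import Literature.MathematicalPhysics.QuantumFieldTheory.Balaban1983to89.Node00.RateRecordW1Reading

/-!
# BalabanUVNodes ∕ N18 — LOCATED, IN THE KERNEL: THE SPACE TABLE OF RECORD `W1.spaceOfRecord` IS `Gᶜ`-VALUED ON THE BONDS OF THE DOMAIN —
# AT THE SU(N) RECORD SL(N,ℂ)-VALUED — HENCE NOT OPEN IN THE CONFIGURATION SPACE `Φ = Sect2.CPair P 𝔸`
# (Track A, DAG node N18 = NE5 `T4OutputRate.NE5 EA EB W κ θ C₅` :211; cluster K4 «SpineRates»; file 11 of seat pub-ymgap-dag-n18-c, row s1,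
# generation 3; the reason for file 10 `BalabanUVNodesN18HLayerW1ConfigRecord` next to file 9 `BalabanUVNodesN18HLayerW1Config` p470180)

Cell `pub-ymgap`, HUMAN RULING D-0062 (Track A), R134 ACCELERATION seat `pub-ymgap-dag-n18-c` (strategy s1), generation 3.  THEOREMS ONLY
(no `def`, no `instance`, no `sorry`); imports NODE 00 definer W1's `Node00/RateRecordW1Reading` (p465810; through it `Node00/HistoryTermsOfRecord`
p455641 with `W1.spaceOfRecord`, def-T's `Node00/Record12` with `settingOfRecord₁₂`, 11b's `Node00/Sect2FrameOfRecord` with `Sect2.spaceI`, pub-balaban's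
`B12RegularSpaces111` ∕ `…SpecialUnitary` ∕ `B13Inv214OrbitSUN.slUnits`); restates nothing.

WHY.  File 9 (p470180) proved the configuration-direction passage «(2.13an) + (2.38) for `H` ⟹ `E^{(k+1)}` analytic + (2.41)-bounded» on space
tables whose members are OPEN in `Φ` (`hsp : IsOpen (sp X)`); file 10 removes that hypothesis by a neighbourhood extension.  THIS FILE records, in
the kernel, WHY the removal is necessary at the record: the space `U^c_j(X, α₀, α₁)` of record is [I]'s union of `Gᶜ`-orbits of configurations
satisfying (1.11)–(1.16) (`B12RegularSpaces111.space'`), read in `Φ` by `Sect2.embedPair`; condition (1.11) makes `𝐔` `Gᶜ`-valued on the bonds of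
`X` and the orbit action `(𝐔,𝐉)^u` (1.10) keeps it so; at the record's model `B12RegularSpaces111SpecialUnitary.suModel N` one has `Gᶜ = slUnits N =
{det = 1}`, a level set in `M_N(ℂ)` — so the space has EMPTY INTERIOR in `Φ = (bonds → M_N(ℂ))²`: scaling one bond variable by real `t → 1` stays
in every open set but leaves `det = 1` (`det(t·U) = t^N`).  (W1's `AnalyticH` is accordingly the AMBIENT reading — analytic at the points of the
space in a `Φ`-neighbourhood — and any Cauchy margin `ball φ ρ ⊆ U^c_j(X)` in `Φ`, as in n22-c's (1.17) face `YMDAG.N22.W1.termDerivBound_of_termBound118`,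
is unsatisfiable at the table of record: LOCATED for that lane, not repaired.)

WHAT (theorems only).
* `exists_units_of_mem_spaceI` — ANY coefficient algebra `𝔸`, any setting `Sg`: every configuration of `Sect2.spaceI Sg Rz M j Y α₀ α₁` is
  `Sg.𝓜.Gc`-valued on the bonds with both ends in `Y` ([I] (1.11) + (1.16), by unfolding `embedPair` ∕ `space` ∕ `act` ∕ `gaugeU` ∕ `Satisfies`).
* `not_isOpen_of_det_eq_one` — `𝔸 = M_N(ℂ)` (`Node00.MatA N`, the record's `Matrix.Norms.L2Operator` normed structure, whose topology is the product
  topology), `N ≠ 0`: a non-empty set of configurations with one bond variable pinned to `det = 1` is not open in `Φ`.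
* `det_eq_one_of_mem_spaceOfRecord₁₂` — at the Stage-12 setting `Node00.settingOfRecord₁₂ F N θ p`: every configuration of
  `W1.spaceOfRecord (settingOfRecord₁₂ F N θ p) Rz α₀ α₁ j X` has `det (Φ.1 b) = 1` on the bonds of `X`.
* `not_isOpen_spaceOfRecord₁₂` — hence, when non-empty (it is under the provisos: `Node00.one_mem_spaceI_stage12`) and `X` holds a bond (both DISPLAYED),
  `W1.spaceOfRecord (settingOfRecord₁₂ F N θ p) Rz α₀ α₁ j X` is NOT OPEN in `Φ`.
* v1.1 `not_isOpen_spaceOfRecord₁₂_of_provisos` — at the record's own residual data `θ.Rz`, cube size `θ.τ9.M` and radii `α_{·,j}(g_j)` along `gOfRecord₁₀`,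
  under `Provisos₁₂` ∧ `Admissible` and in the coupling window: non-emptiness DISCHARGED (`one_mem_spaceI_stage12`); only the bond in `X` displayed;
  `interior_eq_empty_of_det_eq_one`, `interior_spaceOfRecord₁₂_eq_empty` (EMPTY INTERIOR — no non-emptiness hypothesis at all) and
  `not_ball_subset_spaceOfRecord₁₂` (no ball `ball φ ρ`, `ρ > 0`, fits inside the table of record: the (1.17) margin is unsatisfiable there, in the kernel).

HONEST FRAMING — what this is NOT.  Elementary kernel facts about the DEFINITIONS of record (no estimate of Bałaban's is touched); count-neutral; N18 NOT
discharged (typed 28∕28 · discharged 5∕27 UNCHANGED); NE5 NOT IN PRINT, NOT PROVED.  Whether print's analyticity «on U^c_j(X, α₀, α₁)» is best read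
ambiently in `Φ` (W1's `AnalyticOnNhd`) or intrinsically on the complex manifold `(Gᶜ)^{bonds} × (𝔤ᶜ)^{bonds}` is a modelling choice of the definer
lane, not decided here; this file only shows that the ambient reading cannot be paired with «the space is open».  One finite four-torus programme at fixed
`ε`, Bałaban as printed — NOT the continuum limit on ℝ⁴, NOT infinite volume, NOT OS, NOT a mass gap, NOT Clay.  0 `sorry`, 0 `def`; axioms standard.

References (TYPES ∕ loci only): [I] = [Balaban1987RG1] CMP **109** (1987) — (1.9)–(1.16) p. 262, p. 263 (the spaces `U^c_j(X, α₀, α₁)` and analyticity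
on them); [II] = [Balaban1988RG2Cluster] CMP **116** (1988) — the analyticity statement p. 15.
-/

noncomputable section

namespace Summit.QuantumFields.YangMills.BalabanUVNodes.N18HLayerW1SpaceNotOpen

open Set Metric Filter Topology
open Literature.MathematicalPhysics.QuantumFieldTheory.Balaban1983to89
open Literature.MathematicalPhysics.QuantumFieldTheory.Balaban1983to89.T4Continuum (T4Family)
open Literature.MathematicalPhysics.QuantumFieldTheory.Balaban1983to89.Node00
open Literature.MathematicalPhysics.QuantumFieldTheory.Balaban1983to89.Node00.Sect2 (domSys domSites CPair)
open Literature.MathematicalPhysics.QuantumFieldTheory.Balaban1983to89.Node00.W1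

/-! ## The table of record is `Gᶜ`-valued on the bonds of the domain — at the SU(N) record SL(N,ℂ)-valued — hence NOT open in `Φ` -/

section Located

open scoped Matrix.Norms.L2Operator

variable {P : Params} {𝔸 : Type*} [NormedRing 𝔸] [NormedAlgebra ℂ 𝔸] [CompleteSpace 𝔸] {G : Type*} [Group G]

/-- **Every configuration of `U^c_j(X, α₀, α₁)` of record is `Gᶜ`-valued on the bonds of `X`** ([I] (1.11) p. 262 «𝐔 … has values in Gᶜ» + the
`Gᶜ`-orbit union (1.16)): for `Φ ∈ Sect2.spaceI Sg Rz M j Y α₀ α₁` and a bond with both ends in `Y`, `Φ.1 b = u` for some `u ∈ Sg.𝓜.Gc`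
(`u = v(b₋)·𝐔₀(b)·v(b₊)⁻¹`, unfolding `embedPair`, `B12RegularSpaces111.space ∕ act ∕ gaugeU`, `Satisfies`). [folklore] -/
theorem exists_units_of_mem_spaceI (Sg : Sect2.Setting 𝔸 G) (Rz : Sect2.Residual P 𝔸) (M j : ℕ) (Y : Set (Site P 0)) (α₀ α₁ : ℝ)
    {Φ : CPair P 𝔸} (hΦ : Φ ∈ Sect2.spaceI Sg Rz M j Y α₀ α₁) {b : PBond P 0} (hs : b.src ∈ Y) (ht : b.tgt ∈ Y) :
    ∃ u : 𝔸ˣ, u ∈ Sg.𝓜.Gc ∧ Φ.1 b = (u : 𝔸) := by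
  obtain ⟨Ψ, hΨ, rfl⟩ := hΦ
  obtain ⟨v, Φ₀, hv, hsat, rfl⟩ := hΨ
  exact ⟨v b.src * Φ₀.U b * (v b.tgt)⁻¹,
    Sg.𝓜.Gc.mul_mem (Sg.𝓜.Gc.mul_mem (hv _) (hsat.1 b ⟨hs, ht⟩)) (Sg.𝓜.Gc.inv_mem (hv _)), rfl⟩

/-- **A set of configurations with a bond variable pinned to `det = 1` is not open in `Φ`** (`N ≠ 0`, the set non-empty): scaling that bond variable by
real `t → 1` stays in any open set but leaves `det = 1` (`det (t•U) = t^N`).  Elementary topology of `Φ = (bonds → M_N(ℂ))²`. [folklore] -/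
theorem not_isOpen_of_det_eq_one {N : ℕ} (hN : N ≠ 0) (T : Set (CPair P (MatA N))) (b₀ : PBond P 0)
    (hT : ∀ Φ ∈ T, Matrix.det (Φ.1 b₀) = 1) (hne : T.Nonempty) : ¬ IsOpen T := by
  classical
  intro hopen
  obtain ⟨Φ, hΦ⟩ := hne
  -- the ray `t ↦ (𝐔 with 𝐔(b₀) scaled by t, 𝐉)` through `Φ` at `t = 1`
  have hcont : Continuous fun t : ℝ => ((Function.update Φ.1 b₀ ((t : ℂ) • Φ.1 b₀), Φ.2) : CPair P (MatA N)) :=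
    (continuous_const.update b₀ (Complex.continuous_ofReal.smul continuous_const)).prodMk continuous_const
  have h1 : ((Function.update Φ.1 b₀ (((1 : ℝ) : ℂ) • Φ.1 b₀), Φ.2) : CPair P (MatA N)) = Φ := by
    rw [Complex.ofReal_one, one_smul, Function.update_eq_self]
  have hmem : (fun t : ℝ => ((Function.update Φ.1 b₀ ((t : ℂ) • Φ.1 b₀), Φ.2) : CPair P (MatA N))) ⁻¹' T ∈ 𝓝 (1 : ℝ) :=
    hcont.continuousAt.preimage_mem_nhds (by rw [h1]; exact hopen.mem_nhds hΦ)
  obtain ⟨ε, hε, hball⟩ := Metric.mem_nhds_iff.1 hmem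
  have ht : (1 + ε / 2 : ℝ) ∈ Metric.ball (1 : ℝ) ε := by
    rw [Metric.mem_ball, Real.dist_eq, add_sub_cancel_left, abs_of_pos (half_pos hε)]
    exact half_lt_self hε
  have hin : ((Function.update Φ.1 b₀ (((1 + ε / 2 : ℝ) : ℂ) • Φ.1 b₀), Φ.2) : CPair P (MatA N)) ∈ T := hball ht
  have hdet : Matrix.det ((((1 + ε / 2 : ℝ) : ℂ)) • Φ.1 b₀) = 1 := by
    have h := hT _ hin
    simpa only [Function.update_self] using h
  rw [Matrix.det_smul, hT Φ hΦ, mul_one, Fintype.card_fin] at hdet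
  have hreal : (1 + ε / 2 : ℝ) ^ N = 1 := by exact_mod_cast hdet
  exact absurd hreal (one_lt_pow₀ (by linarith) hN).ne'

/-- **THE TABLE OF RECORD IS SL(N,ℂ)-VALUED ON THE BONDS OF THE DOMAIN** (Stage-12 setting `Node00.settingOfRecord₁₂`, model `suModel N`, `Gᶜ = slUnits N`):
for `Φ ∈ W1.spaceOfRecord (settingOfRecord₁₂ F N θ p) Rz α₀ α₁ j X` and a bond `b` with both ends in the sites of `X`, `det (Φ.1 b) = 1`. [folklore] -/
theorem det_eq_one_of_mem_spaceOfRecord₁₂ (F : T4Family) (N : ℕ) [NeZero N] (θ : Stage12Params F N) (p : B12.RunParams)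
    (Rz : Sect2.Residual (F.P p.K) (MatA N)) {M : ℕ} (α₀ α₁ : ℕ → ℝ) (j : ℕ) (X : (domSys (F.P p.K) M j).Dom)
    {Φ : CPair (F.P p.K) (MatA N)} (hΦ : Φ ∈ W1.spaceOfRecord (M := M) (settingOfRecord₁₂ F N θ p) Rz α₀ α₁ j X)
    {b : PBond (F.P p.K) 0} (hs : b.src ∈ Sect2.domSites (F.P p.K) M j X) (ht : b.tgt ∈ Sect2.domSites (F.P p.K) M j X) :
    Matrix.det (Φ.1 b) = 1 := by
  obtain ⟨u, hu, h⟩ := exists_units_of_mem_spaceI (settingOfRecord₁₂ F N θ p) Rz M j _ (α₀ j) (α₁ j) hΦ hs ht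
  rw [h]
  exact B13Inv214OrbitSUN.mem_slUnits_iff.1 hu

/-- **LOCATED: `U^c_j(X, α₀, α₁)` OF RECORD IS NOT OPEN IN `Φ`** whenever it is non-empty (it is, under the provisos: `Node00.one_mem_spaceI_stage12`) and `X`
contains a bond — so the open-table hypothesis `IsOpen (sp X)` of file 9 (and any `ball φ ρ ⊆ sp j X` margin) is unsatisfiable at `spaceOfRecord`;
file 10 `BalabanUVNodesN18HLayerW1ConfigRecord` is the repair. [folklore] -/
theorem not_isOpen_spaceOfRecord₁₂ (F : T4Family) (N : ℕ) [NeZero N] (θ : Stage12Params F N) (p : B12.RunParams)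
    (Rz : Sect2.Residual (F.P p.K) (MatA N)) {M : ℕ} (α₀ α₁ : ℕ → ℝ) (j : ℕ) (X : (domSys (F.P p.K) M j).Dom)
    {b₀ : PBond (F.P p.K) 0} (hs : b₀.src ∈ Sect2.domSites (F.P p.K) M j X) (ht : b₀.tgt ∈ Sect2.domSites (F.P p.K) M j X)
    (hne : (W1.spaceOfRecord (M := M) (settingOfRecord₁₂ F N θ p) Rz α₀ α₁ j X).Nonempty) :
    ¬ IsOpen (W1.spaceOfRecord (M := M) (settingOfRecord₁₂ F N θ p) Rz α₀ α₁ j X) :=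
  not_isOpen_of_det_eq_one (NeZero.ne N) _ b₀
    (fun _ hΦ => det_eq_one_of_mem_spaceOfRecord₁₂ F N θ p Rz α₀ α₁ j X hΦ hs ht) hne

/-! ## v1.1 (append-only) — AT THE RECORD's OWN RADII AND RESIDUAL DATA, non-emptiness discharged by the provisos -/

/-- **v1.1 — NOT OPEN AT THE RECORD, UNDER THE PROVISOS**: for an admissible Stage-12 parameter `θ` satisfying `Provisos₁₂`, a run `p`, a level `j` whose
generated coupling lies in the window `]0, γ]` (`hw`), and a domain `X` of record (`M = θ.τ9.M`) holding a bond, the space of record `U^c_j(X, α_{0,j}, α_{1,j})`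
— `W1.spaceOfRecord (settingOfRecord₁₂ F N θ p) (θ.Rz p.K)` at the record's radii `α_{·,j} = (lfOfRecord₁₂ θ).alpha· (g_j)` along `gOfRecord₁₀` — is NOT
OPEN in `Φ`: the non-emptiness hypothesis of `not_isOpen_spaceOfRecord₁₂` is DISCHARGED by def-T's `Node00.one_mem_spaceI_stage12` (the unit configuration
lies in the space).  Only the bond in `X` stays displayed. [folklore] -/
theorem not_isOpen_spaceOfRecord₁₂_of_provisos (F : T4Family) (N : ℕ) [NeZero N] {θ : Stage12Params F N} (h : θ.Provisos₁₂ F N)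
    (hθ : θ.Admissible F N) (p : B12.RunParams) (j : ℕ) (X : (domSys (F.P p.K) θ.τ9.M j).Dom)
    (hw : 0 < gOfRecord₁₀ F N θ.toStage9Params p j ∧ gOfRecord₁₀ F N θ.toStage9Params p j ≤ θ.γ)
    {b₀ : PBond (F.P p.K) 0} (hs : b₀.src ∈ Sect2.domSites (F.P p.K) θ.τ9.M j X) (ht : b₀.tgt ∈ Sect2.domSites (F.P p.K) θ.τ9.M j X) :
    ¬ IsOpen (W1.spaceOfRecord (M := θ.τ9.M) (settingOfRecord₁₂ F N θ p) (θ.Rz p.K)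
      (fun i => (lfOfRecord₁₂ F N θ).alpha0 (gOfRecord₁₀ F N θ.toStage9Params p i))
      (fun i => (lfOfRecord₁₂ F N θ).alpha1 (gOfRecord₁₀ F N θ.toStage9Params p i)) j X) :=
  not_isOpen_spaceOfRecord₁₂ F N θ p (θ.Rz p.K) _ _ j X hs ht ⟨_, one_mem_spaceI_stage12 h hθ p j _ hw⟩

/-- **v1.1 — EMPTY INTERIOR** (the sharper form, no non-emptiness needed): a set of configurations with one bond variable pinned to `det = 1` has EMPTY
INTERIOR in `Φ` (`not_isOpen_of_det_eq_one` applied to the open set `interior T ⊆ T`). [folklore] -/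
theorem interior_eq_empty_of_det_eq_one {N : ℕ} (hN : N ≠ 0) (T : Set (CPair P (MatA N))) (b₀ : PBond P 0)
    (hT : ∀ Φ ∈ T, Matrix.det (Φ.1 b₀) = 1) : interior T = ∅ := by
  by_contra h
  exact not_isOpen_of_det_eq_one hN (interior T) b₀ (fun Φ hΦ => hT Φ (interior_subset hΦ))
    (Set.nonempty_iff_ne_empty.2 h) isOpen_interior

/-- **v1.1 — THE TABLE OF RECORD HAS EMPTY INTERIOR IN `Φ`** (Stage-12 setting; only «a bond in `X`» displayed, NO non-emptiness hypothesis): in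
particular no ball `Metric.ball φ ρ`, `ρ > 0`, fits inside `W1.spaceOfRecord (settingOfRecord₁₂ F N θ p) Rz α₀ α₁ j X` — the Cauchy margins of the
(1.17) faces must be taken in a thickening (file 13 `BalabanUVNodesN18HLayerW1Thickened`). [folklore] -/
theorem interior_spaceOfRecord₁₂_eq_empty (F : T4Family) (N : ℕ) [NeZero N] (θ : Stage12Params F N) (p : B12.RunParams)
    (Rz : Sect2.Residual (F.P p.K) (MatA N)) {M : ℕ} (α₀ α₁ : ℕ → ℝ) (j : ℕ) (X : (domSys (F.P p.K) M j).Dom)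
    {b₀ : PBond (F.P p.K) 0} (hs : b₀.src ∈ Sect2.domSites (F.P p.K) M j X) (ht : b₀.tgt ∈ Sect2.domSites (F.P p.K) M j X) :
    interior (W1.spaceOfRecord (M := M) (settingOfRecord₁₂ F N θ p) Rz α₀ α₁ j X) = ∅ :=
  interior_eq_empty_of_det_eq_one (NeZero.ne N) _ b₀
    fun _ hΦ => det_eq_one_of_mem_spaceOfRecord₁₂ F N θ p Rz α₀ α₁ j X hΦ hs ht

/-- **v1.1 — NO BALL FITS**: for every configuration `φ` and `ρ > 0`, `¬ Metric.ball φ ρ ⊆ W1.spaceOfRecord …` (so the margin hypothesis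
`ball φ ρ ⊆ sp j X` of the (1.17) faces is unsatisfiable at `sp := spaceOfRecord` whenever `sp′ j X` is non-empty, in the kernel). [folklore] -/
theorem not_ball_subset_spaceOfRecord₁₂ (F : T4Family) (N : ℕ) [NeZero N] (θ : Stage12Params F N) (p : B12.RunParams)
    (Rz : Sect2.Residual (F.P p.K) (MatA N)) {M : ℕ} (α₀ α₁ : ℕ → ℝ) (j : ℕ) (X : (domSys (F.P p.K) M j).Dom)
    {b₀ : PBond (F.P p.K) 0} (hs : b₀.src ∈ Sect2.domSites (F.P p.K) M j X) (ht : b₀.tgt ∈ Sect2.domSites (F.P p.K) M j X)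
    (φ : CPair (F.P p.K) (MatA N)) {ρ : ℝ} (hρ : 0 < ρ) :
    ¬ Metric.ball φ ρ ⊆ W1.spaceOfRecord (M := M) (settingOfRecord₁₂ F N θ p) Rz α₀ α₁ j X := by
  intro hsub
  have hmem : φ ∈ interior (W1.spaceOfRecord (M := M) (settingOfRecord₁₂ F N θ p) Rz α₀ α₁ j X) :=
    interior_maximal hsub Metric.isOpen_ball (Metric.mem_ball_self hρ)
  rw [interior_spaceOfRecord₁₂_eq_empty F N θ p Rz α₀ α₁ j X hs ht] at hmem
  exact hmem

end Located

end Summit.QuantumFields.YangMills.BalabanUVNodes.N18HLayerW1SpaceNotOpen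

end
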